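import Mathlib
import HarnessLib
import Literature.MathematicalPhysics.StatisticalMechanics.FluctuationKernelComparisonTransfer
import Literature.MathematicalPhysics.StatisticalMechanics.StepMeasureComparisonTraceSecond

/-!
# Lemma 8.4 with `ℓ = 2`, SECOND-ORDER PART, dimension-free, comparison on an auxiliary (small) torus:
# `‖fluct 𝒞a K − 2·fluct ½(𝒞a+𝒞b) K + fluct 𝒞b K‖_{T, w_{k:k+1}^X} ≤ C·(r₀+1)·27q²h_S²·(A𝒫p^{|X|_k})^{1/p}`
# ([Buc16] Lemma 4.1 + Thm 4.5 (`ℓ = 2`); [ABKM19] Lemma 8.4 / Lemma 12.6 with `ℓ = 2`)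

Twin of `FluctuationKernelComparisonTransfer.tayNormLE_fluct_sub_fluct_of_sum_sq_transfer` (the `ℓ = 1`
localisation engine) for the GENUINE second-order part of the second difference of the integration map along
a linear segment of step kernels `𝒞_t = 𝒞b + t(𝒞a − 𝒞b)`: the three expectations (under `𝒞a`, the exact
midpoint kernel `½𝒞b + ½𝒞a`, and `𝒞b`) of the derivatives of the lift of an `X`-local functional are
transferred to an auxiliary torus reproducing the covariances on the support `S` of the functional
(`GaussianMarginalTransfer`), where the no-smallness second-order comparison of multiplier Gaussians
`StepMeasureComparisonTraceSecond.norm_integral_mulMat_secondDiff_le_of_sum_sq_segment` prices the second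
difference by `27 q² h_S²`, `h_S² ≥ Σ_{κ'} ρ'(κ')²` the Hilbert–Schmidt size of the mode-wise two-sided relative
bound between the END-POINT multipliers on the small torus — the SAME datum as for `ℓ = 1`, now entering
quadratically.  The `L^p` norms along the segment are controlled by the weight bounds (w7′) of the big torus
exactly as in the `ℓ = 1` engine.

* **`tayNormLE_fluct_secondDiff_of_sum_sq_transfer`** —
  `‖fluct 𝒞a K − 2•fluct (½𝒞b + ½𝒞a) K + fluct 𝒞b K‖_{T, w_{k:k+1}^X} ≤ C·((r₀+1)·(27 q² h_S²)·(A𝒫p^{|X|_k})^{1/p})`.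

Together with the first-order part `2[fluct ½(𝒞₀+𝒞₂) − fluct 𝒞₁]` (`FluctuationKernelComparisonMid*`) this is
the full `ℓ = 2` slot of [ABKM19] Lemma 8.4 along a line of tuning parameters.  Everything is proved; no
named fact.

## References
* S. Buchholz, J. Funct. Anal. 275 (2018), Lemma 4.1, Thm 4.5 [Buchholz2016].
* S. Adams, S. Buchholz, R. Kotecký, S. Müller, arXiv:1910.13564, Lemma 8.4, Lemma 12.6
  [AdamsBuchholzKoteckyMuller2019].
-/

noncomputable section

namespace Literature.MathematicalPhysics.StatisticalMechanics.GradientRG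

open scoped BigOperators Matrix ENNReal
open MeasureTheory ProbabilityTheory Finset WithLp Matrix
open Literature.MathematicalPhysics.StatisticalMechanics.GradientFRD (mulMat fourierCoeff
  re_fourierCoeff_zero_of_sum_eq_zero circulant_eq_mulMat posSemidef_mulMat)
open Literature.MathematicalPhysics.StatisticalMechanics.TorusPolymer (IsPolymer numBlocks)
open Literature.MathematicalPhysics.QuantumFieldTheory
open Literature.Probability.Distributions (integral_comp_sel_multivariateGaussian_eq
  integrable_comp_sel_multivariateGaussian_iff)

variable {d M Mb : ℕ} [NeZero M] [NeZero Mb]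

set_option maxHeartbeats 1600000 in
/-- **[ABKM19] Lemma 8.4 (`ℓ = 2`, second-order part), dimension-free, comparison on an auxiliary torus**
(module docstring).  Big torus `(ℤ/M)^d`: local dominated weights `W`, even zero-sum step kernels `𝒞a, 𝒞b`
with `StepKernelBounds` at scale `k` (also for the midpoint kernel `½𝒞b + ½𝒞a`), positive multipliers off
the zero mode, and `StepKernelBounds` for the dilated kernel segment `p·(𝒞b + t(𝒞a − 𝒞b))`; a gauge `T`
killing constants and seeing the field only on the finite set `S`; a `T`-local `C^{r₀}` functional `K` with
`‖K‖_{T,w_k^X} ≤ C`.  Auxiliary torus `(ℤ/M̄)^d`: a map of sites `e` and even kernels `𝒞a', 𝒞b'` with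
nonnegative multipliers, positive off the zero mode, reproducing the covariances on `S`, and a mode-wise
two-sided relative bound `ρ' ≥ 0` with `Σ ρ'² ≤ h_S²`.  Then
`‖fluct 𝒞a K − 2•fluct (½𝒞b + ½𝒞a) K + fluct 𝒞b K‖_{T, w_{k:k+1}^X} ≤ C·((r₀+1)·(27 q² h_S²)·(A𝒫p^{|X|_k})^{1/p})`.
[cite: Buchholz2016, Lemma 4.1 / Thm 4.5] -/
theorem tayNormLE_fluct_secondDiff_of_sum_sq_transfer (W : WeightData (Fin d → ZMod M))
    {nb : ℕ → Finset (Fin d → ZMod M) → Finset (Fin d → ZMod M)} (hWl : W.Local nb)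
    {Dm : ℕ → Matrix (Fin d → ZMod M) (Fin d → ZMod M) ℝ} (hD : W.Dominated Dm)
    {L k : ℕ} {A𝒫a A𝒫b A𝒫m A𝒫p C₂a C₂b C₂m C₂p : ℝ} {𝒞a 𝒞b : (Fin d → ZMod M) → ℝ}
    (hSa : StepKernelBounds W L k A𝒫a C₂a 𝒞a) (hSb : StepKernelBounds W L k A𝒫b C₂b 𝒞b)
    (hSm : StepKernelBounds W L k A𝒫m C₂m (fun x => 2⁻¹ * 𝒞b x + 2⁻¹ * 𝒞a x))
    {p q : ℝ} (hpq : p.HolderConjugate q)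
    (hSp : ∀ t ∈ Set.Icc (0 : ℝ) 1,
      StepKernelBounds W L k A𝒫p C₂p (fun x => p * (𝒞b x + t * (𝒞a x - 𝒞b x))))
    (hea : ∀ x, 𝒞a (-x) = 𝒞a x) (heb : ∀ x, 𝒞b (-x) = 𝒞b x)
    (h0a : ∑ x, 𝒞a x = 0) (h0b : ∑ x, 𝒞b x = 0)
    (hposa : ∀ κ, κ ≠ 0 → 0 < (fourierCoeff 𝒞a κ).re)
    (hposb : ∀ κ, κ ≠ 0 → 0 < (fourierCoeff 𝒞b κ).re)
    -- the auxiliary torus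
    (e : (Fin d → ZMod M) → (Fin d → ZMod Mb)) (S : Finset (Fin d → ZMod M))
    {𝒞a' 𝒞b' : (Fin d → ZMod Mb) → ℝ}
    (hea' : ∀ z, 𝒞a' (-z) = 𝒞a' z) (heb' : ∀ z, 𝒞b' (-z) = 𝒞b' z)
    (hnna' : ∀ κ, 0 ≤ (fourierCoeff 𝒞a' κ).re) (hnnb' : ∀ κ, 0 ≤ (fourierCoeff 𝒞b' κ).re)
    (hposa' : ∀ κ, κ ≠ 0 → 0 < (fourierCoeff 𝒞a' κ).re)
    (hposb' : ∀ κ, κ ≠ 0 → 0 < (fourierCoeff 𝒞b' κ).re)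
    (hcova : ∀ x ∈ S, ∀ y ∈ S, 𝒞a' (e x - e y) = 𝒞a (x - y))
    (hcovb : ∀ x ∈ S, ∀ y ∈ S, 𝒞b' (e x - e y) = 𝒞b (x - y))
    {ρ : (Fin d → ZMod Mb) → ℝ} (hρ : ∀ κ, 0 ≤ ρ κ)
    (hcmpa : ∀ κ, |(fourierCoeff 𝒞a' κ).re - (fourierCoeff 𝒞b' κ).re| ≤ ρ κ * (fourierCoeff 𝒞a' κ).re)
    (hcmpb : ∀ κ, |(fourierCoeff 𝒞a' κ).re - (fourierCoeff 𝒞b' κ).re| ≤ ρ κ * (fourierCoeff 𝒞b' κ).re)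
    {hS : ℝ} (hhS : 0 ≤ hS) (hsum : ∑ κ, ρ κ ^ 2 ≤ hS ^ 2)
    -- the polymer, the gauge, the functional
    {X : Finset (Fin d → ZMod M)} (hX : IsPolymer (L ^ k) X)
    {V : Type*} [NormedAddCommGroup V] [NormedSpace ℝ V]
    (T : ((Fin d → ZMod M) → ℝ) →ₗ[ℝ] V) (hT : ∀ a : ℝ, T (fun _ => a) = 0)
    (hTloc : ∀ ζ ζ' : (Fin d → ZMod M) → ℝ, (∀ x ∈ S, ζ x = ζ' x) → T ζ = T ζ')
    {r₀ : ℕ} {K : ((Fin d → ZMod M) → ℝ) → ℂ} {C : ℝ}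
    (hC : 0 ≤ C) (hKd : ContDiff ℝ r₀ K) (hKloc : IsGaugeLocal T K)
    (hK : TayNormLE T r₀ (W.weight k X) K C) :
    TayNormLE T r₀ (W.midWeight k X)
      (fluct 𝒞a K - (2 : ℝ) • fluct (fun x => 2⁻¹ * 𝒞b x + 2⁻¹ * 𝒞a x) K + fluct 𝒞b K)
      (C * ((r₀ + 1) * (27 * q ^ 2 * hS ^ 2) * (A𝒫p ^ numBlocks (L ^ k) X) ^ (1 / p))) := by
  classical
  intro φ
  set 𝒞m : (Fin d → ZMod M) → ℝ := fun x => 2⁻¹ * 𝒞b x + 2⁻¹ * 𝒞a x with h𝒞m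
  have hp1 : 1 < p := hpq.lt
  have hp0 : 0 < p := by linarith
  have hq0 : 0 < q := by linarith [hpq.symm.lt]
  have hpE : ENNReal.ofReal p ≠ 0 := by simp [hp0]
  set Kbar := gaugeLift T K with hKbar
  have hKbar_d : ContDiff ℝ r₀ Kbar := contDiff_gaugeLift T hKd
  set Ap := A𝒫p ^ numBlocks (L ^ k) X with hAp
  have hwm := W.midWeight_pos k X φ
  have hAp0 : 0 ≤ Ap := by
    by_contra hneg
    push Not at hneg
    have h1 := (hSp 0 ⟨le_rfl, zero_le_one⟩).pow_mul_midWeight_nonneg hX φ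
    exact absurd h1 (not_le.2 (mul_neg_of_neg_of_pos hneg hwm))
  -- big torus: nonnegative multipliers and the segment
  have h0a' : 0 ≤ (fourierCoeff 𝒞a 0).re := re_fourierCoeff_zero_nonneg_of_sum_eq_zero h0a
  have h0b' : 0 ≤ (fourierCoeff 𝒞b 0).re := re_fourierCoeff_zero_nonneg_of_sum_eq_zero h0b
  have hnna : ∀ κ, 0 ≤ (fourierCoeff 𝒞a κ).re := fun κ => by
    by_cases hκ : κ = 0
    · rw [hκ]; exact h0a'
    · exact (hposa κ hκ).le
  have hnnb : ∀ κ, 0 ≤ (fourierCoeff 𝒞b κ).re := fun κ => by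
    by_cases hκ : κ = 0
    · rw [hκ]; exact h0b'
    · exact (hposb κ hκ).le
  have hpsd_t : ∀ t ∈ Set.Icc (0 : ℝ) 1,
      (Matrix.circulant (fun x => 𝒞b x + t * (𝒞a x - 𝒞b x))).PosSemidef := fun t ht =>
    posSemidef_circulant_kernelSeg hea heb hnna hnnb ht.1 ht.2
  -- small torus: regularised multipliers
  set ma : (Fin d → ZMod Mb) → ℝ :=
    fun κ => (fourierCoeff 𝒞a' κ).re + if κ = 0 then (1 : ℝ) * (Mb : ℝ) ^ d else 0 with hma
  set mb : (Fin d → ZMod Mb) → ℝ :=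
    fun κ => (fourierCoeff 𝒞b' κ).re + if κ = 0 then (1 : ℝ) * (Mb : ℝ) ^ d else 0 with hmb
  have hSa'_eq : Matrix.circulant 𝒞a' + constMat 1 = mulMat ma := circulant_add_constMat_eq_mulMat hea' 1
  have hSb'_eq : Matrix.circulant 𝒞b' + constMat 1 = mulMat mb := circulant_add_constMat_eq_mulMat heb' 1
  have hma_pos : ∀ κ, 0 < ma κ := re_fourierCoeff_add_zeroModeMul_pos hposa' (hnna' 0) one_pos
  have hmb_pos : ∀ κ, 0 < mb κ := re_fourierCoeff_add_zeroModeMul_pos hposb' (hnnb' 0) one_pos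
  have hma_ev : ∀ κ, ma (-κ) = ma κ := re_fourierCoeff_add_zeroModeMul_neg hea' 1
  have hmb_ev : ∀ κ, mb (-κ) = mb κ := re_fourierCoeff_add_zeroModeMul_neg heb' 1
  have hdiff : ∀ κ, ma κ - mb κ = (fourierCoeff 𝒞a' κ).re - (fourierCoeff 𝒞b' κ).re := by
    intro κ; simp only [hma, hmb]; ring
  have hρb : ∀ κ, |ma κ - mb κ| ≤ ρ κ * mb κ := by
    intro κ
    rw [hdiff]
    refine (hcmpb κ).trans (mul_le_mul_of_nonneg_left ?_ (hρ κ))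
    simp only [hmb]
    split_ifs <;> [exact le_add_of_nonneg_right (by positivity); exact (add_zero _).symm.le]
  have hρa : ∀ κ, |ma κ - mb κ| ≤ ρ κ * ma κ := by
    intro κ
    rw [hdiff]
    refine (hcmpa κ).trans (mul_le_mul_of_nonneg_left ?_ (hρ κ))
    simp only [hma]
    split_ifs <;> [exact le_add_of_nonneg_right (by positivity); exact (add_zero _).symm.le]
  have hmt_eq : ∀ t : ℝ, mulMat (fun κ => mb κ + t * (ma κ - mb κ)) =
      Matrix.circulant (fun z => 𝒞b' z + t * (𝒞a' z - 𝒞b' z)) + constMat 1 := fun t =>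
    mulMat_mulSeg_eq_circulant_kernelSeg_add_constMat hea' heb' 1 t
  have hpsd_t' : ∀ t ∈ Set.Icc (0 : ℝ) 1,
      (Matrix.circulant (fun z => 𝒞b' z + t * (𝒞a' z - 𝒞b' z))).PosSemidef := fun t ht =>
    posSemidef_circulant_kernelSeg hea' heb' hnna' hnnb' ht.1 ht.2
  -- the covariance identity along the segment
  have hcov_t : ∀ (t : ℝ), ∀ x ∈ S, ∀ y ∈ S,
      (Matrix.circulant (fun x => 𝒞b x + t * (𝒞a x - 𝒞b x)) + constMat 1 :
          Matrix (Fin d → ZMod M) (Fin d → ZMod M) ℝ) x y =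
        (Matrix.circulant (fun z => 𝒞b' z + t * (𝒞a' z - 𝒞b' z)) + constMat 1 :
          Matrix (Fin d → ZMod Mb) (Fin d → ZMod Mb) ℝ) (e x) (e y) := by
    intro t x hx y hy
    rw [circulant_add_constMat_apply, circulant_add_constMat_apply, hcova x hx y hy, hcovb x hx y hy]
  -- extension by zero off `S` and the pull-back along `e`
  set ext : (↥S → ℝ) → ((Fin d → ZMod M) → ℝ) := fun u x => if hx : x ∈ S then u ⟨x, hx⟩ else 0 with hext
  have hext_cont : Continuous ext := by
    refine continuous_pi fun x => ?_
    by_cases hx : x ∈ S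
    · simp only [hext, dif_pos hx]; exact continuous_apply _
    · simp only [hext, dif_neg hx]; exact continuous_const
  have hext_agree : ∀ (ζ : (Fin d → ZMod M) → ℝ), ∀ x ∈ S, ext (fun s : ↥S => ζ s) x = ζ x := by
    intro ζ x hx; simp only [hext, dif_pos hx]
  -- `T.rangeRestrict` kills the constants
  have hTr : ∀ a : ℝ, T.rangeRestrict (fun _ : Fin d → ZMod M => a) = 0 := fun a =>
    Subtype.ext (hT a)
  have hTrloc : ∀ ζ ζ' : (Fin d → ZMod M) → ℝ, (∀ x ∈ S, ζ x = ζ' x) →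
      T.rangeRestrict ζ = T.rangeRestrict ζ' := fun ζ ζ' h => Subtype.ext (hTloc ζ ζ' h)
  -- per-order estimate
  have hterm : ∀ s, s ≤ r₀ →
      ‖iteratedFDeriv ℝ s (gaugeLift T (fluct 𝒞a K - (2 : ℝ) • fluct 𝒞m K + fluct 𝒞b K))
          (T.rangeRestrict φ)‖ ≤
        (s.factorial : ℝ) * C * (27 * q ^ 2 * hS ^ 2 * Ap ^ (1 / p)) * W.midWeight k X φ := by
    intro s hs
    have hs' : (s : WithTop ℕ∞) ≤ r₀ := by exact_mod_cast hs
    set G : ((Fin d → ZMod M) → ℝ) → _ :=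
      fun ζ => iteratedFDeriv ℝ s Kbar (T.rangeRestrict φ + T.rangeRestrict ζ) with hG
    -- (1) the derivative of the lift of the difference
    have hDa := hK.derivDominated_section hC hKd (hSa.weightSectionDominated hD X T)
    have hDb := hK.derivDominated_section hC hKd (hSb.weightSectionDominated hD X T)
    have hDm := hK.derivDominated_section hC hKd (hSm.weightSectionDominated hD X T)
    have hlift_a : gaugeLift T (fluct 𝒞a K) =
        fun w => ∫ ζ, Kbar (w + T.rangeRestrict ζ) ∂(stepMeasure 𝒞a) := by
      funext w; exact gaugeLift_integral_comp_add hKloc _ w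
    have hlift_b : gaugeLift T (fluct 𝒞b K) =
        fun w => ∫ ζ, Kbar (w + T.rangeRestrict ζ) ∂(stepMeasure 𝒞b) := by
      funext w; exact gaugeLift_integral_comp_add hKloc _ w
    have hlift_m : gaugeLift T (fluct 𝒞m K) =
        fun w => ∫ ζ, Kbar (w + T.rangeRestrict ζ) ∂(stepMeasure 𝒞m) := by
      funext w; exact gaugeLift_integral_comp_add hKloc _ w
    have hDs_a : iteratedFDeriv ℝ s (gaugeLift T (fluct 𝒞a K)) (T.rangeRestrict φ) =
        ∫ ζ, G ζ ∂(stepMeasure 𝒞a) := by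
      rw [hlift_a, hDa.iteratedFDeriv_integral_eq s hs]
      refine integral_congr_ae (ae_of_all _ fun ζ => ?_)
      simp only [hG]
      rw [iteratedFDeriv_comp_add_right]
    have hDs_b : iteratedFDeriv ℝ s (gaugeLift T (fluct 𝒞b K)) (T.rangeRestrict φ) =
        ∫ ζ, G ζ ∂(stepMeasure 𝒞b) := by
      rw [hlift_b, hDb.iteratedFDeriv_integral_eq s hs]
      refine integral_congr_ae (ae_of_all _ fun ζ => ?_)
      simp only [hG]
      rw [iteratedFDeriv_comp_add_right]
    have hDs_m : iteratedFDeriv ℝ s (gaugeLift T (fluct 𝒞m K)) (T.rangeRestrict φ) =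
        ∫ ζ, G ζ ∂(stepMeasure 𝒞m) := by
      rw [hlift_m, hDm.iteratedFDeriv_integral_eq s hs]
      refine integral_congr_ae (ae_of_all _ fun ζ => ?_)
      simp only [hG]
      rw [iteratedFDeriv_comp_add_right]
    have hca : ContDiff ℝ r₀ (gaugeLift T (fluct 𝒞a K)) :=
      contDiff_gaugeLift T (hSa.contDiff_fluct hD X T hC hKd hKloc hK)
    have hcb : ContDiff ℝ r₀ (gaugeLift T (fluct 𝒞b K)) :=
      contDiff_gaugeLift T (hSb.contDiff_fluct hD X T hC hKd hKloc hK)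
    have hcm : ContDiff ℝ r₀ (gaugeLift T (fluct 𝒞m K)) :=
      contDiff_gaugeLift T (hSm.contDiff_fluct hD X T hC hKd hKloc hK)
    have hsub : gaugeLift T (fluct 𝒞a K - (2 : ℝ) • fluct 𝒞m K + fluct 𝒞b K) =
        gaugeLift T (fluct 𝒞a K) - (2 : ℝ) • gaugeLift T (fluct 𝒞m K) + gaugeLift T (fluct 𝒞b K) := by
      funext w; rfl
    have hcm2 : ContDiffAt ℝ s ((2 : ℝ) • gaugeLift T (fluct 𝒞m K)) (T.rangeRestrict φ) :=
      ((hcm.of_le hs').const_smul (2 : ℝ)).contDiffAt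
    have hcam : ContDiffAt ℝ s (gaugeLift T (fluct 𝒞a K) - (2 : ℝ) • gaugeLift T (fluct 𝒞m K))
        (T.rangeRestrict φ) :=
      (hca.of_le hs').contDiffAt.sub hcm2
    rw [hsub, iteratedFDeriv_add_apply hcam ((hcb.of_le hs').contDiffAt),
      iteratedFDeriv_sub_apply ((hca.of_le hs').contDiffAt) hcm2,
      iteratedFDeriv_const_smul_apply ((hcm.of_le hs').contDiffAt), hDs_a, hDs_b, hDs_m]
    -- (2) properties of `G`
    have hGcont : Continuous G := by
      show Continuous fun ζ => iteratedFDeriv ℝ s Kbar (T.rangeRestrict φ + gaugeRestrictCLM T ζ)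
      exact (hKbar_d.continuous_iteratedFDeriv hs').comp
        (continuous_const.add (gaugeRestrictCLM T).continuous)
    have hGinv : ∀ (ζ : (Fin d → ZMod M) → ℝ) (a : ℝ), G (ζ + fun _ => a) = G ζ := by
      intro ζ a
      simp only [hG]
      rw [map_add, hTr a, add_zero]
    have hGloc : ∀ ζ ζ' : (Fin d → ZMod M) → ℝ, (∀ x ∈ S, ζ x = ζ' x) → G ζ = G ζ' := by
      intro ζ ζ' h
      simp only [hG]
      rw [hTrloc ζ ζ' h]
    have hGbound : ∀ ζ, ‖G ζ‖ ≤ (s.factorial : ℝ) * C * W.weight k X (φ + ζ) := by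
      intro ζ
      have hcoef := pow_div_factorial_mul_norm_iteratedFDeriv_le_tphiSeminorm r₀ zero_le_one Kbar
        (T.rangeRestrict (φ + ζ)) hs
      rw [one_pow, ← tayNorm_eq_tphiSeminorm] at hcoef
      have hfac : (0 : ℝ) < s.factorial := by positivity
      rw [div_mul_eq_mul_div, one_mul, div_le_iff₀ hfac] at hcoef
      have hpt : T.rangeRestrict φ + T.rangeRestrict ζ = T.rangeRestrict (φ + ζ) := (map_add _ _ _).symm
      simp only [hG]
      rw [hpt]
      calc ‖iteratedFDeriv ℝ s Kbar (T.rangeRestrict (φ + ζ))‖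
          ≤ tayNorm T r₀ K (φ + ζ) * s.factorial := hcoef
        _ ≤ C * W.weight k X (φ + ζ) * s.factorial :=
            mul_le_mul_of_nonneg_right (hK _) (Nat.cast_nonneg _)
        _ = (s.factorial : ℝ) * C * W.weight k X (φ + ζ) := by ring
    have hGm : Continuous fun y : EuclideanSpace ℝ (Fin d → ZMod M) => G (ofLp y) :=
      hGcont.comp (PiLp.continuous_ofLp 2 _)
    -- the functional of the restricted field and its pull-back to the small torus
    set g : (↥S → ℝ) → _ := fun u => G (ext u) with hg
    have hgcont : Continuous g := hGcont.comp hext_cont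
    have hgm : StronglyMeasurable g := hgcont.stronglyMeasurable
    have hG_eq_g : ∀ ζ : (Fin d → ZMod M) → ℝ, G ζ = g (fun s : ↥S => ζ s) := by
      intro ζ
      simp only [hg]
      exact hGloc _ _ fun x hx => (hext_agree ζ x hx).symm
    set Gs : ((Fin d → ZMod Mb) → ℝ) → _ := fun ψ => g (fun s : ↥S => ψ (e s)) with hGs
    have hpull : Continuous fun ψ : (Fin d → ZMod Mb) → ℝ => (fun s : ↥S => ψ (e s)) :=
      continuous_pi fun s : ↥S => (continuous_apply (e (s : Fin d → ZMod M)) :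
        Continuous fun ψ : (Fin d → ZMod Mb) → ℝ => ψ (e (s : Fin d → ZMod M)))
    have hGs_cont : Continuous Gs := hgcont.comp hpull
    have hGsm : Continuous fun y : EuclideanSpace ℝ (Fin d → ZMod Mb) => Gs (ofLp y) :=
      hGs_cont.comp (PiLp.continuous_ofLp 2 _)
    -- (3) transfer both expectations to the regularised Gaussians, then to the small torus
    have hreg : ∀ t ∈ Set.Icc (0 : ℝ) 1,
        (Matrix.circulant (fun x => 𝒞b x + t * (𝒞a x - 𝒞b x)) + constMat 1 :
          Matrix (Fin d → ZMod M) (Fin d → ZMod M) ℝ).PosSemidef := fun t ht =>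
      (hpsd_t t ht).add (posSemidef_constMat zero_le_one)
    have hreg' : ∀ t ∈ Set.Icc (0 : ℝ) 1,
        (Matrix.circulant (fun z => 𝒞b' z + t * (𝒞a' z - 𝒞b' z)) + constMat 1 :
          Matrix (Fin d → ZMod Mb) (Fin d → ZMod Mb) ℝ).PosSemidef := fun t ht =>
      (hpsd_t' t ht).add (posSemidef_constMat zero_le_one)
    have htransfer : ∀ (t : ℝ) (ht : t ∈ Set.Icc (0 : ℝ) 1),
        ∫ y, g (fun s : ↥S => (ofLp y) (s : Fin d → ZMod M))
            ∂(multivariateGaussian (0 : EuclideanSpace ℝ (Fin d → ZMod M))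
              (Matrix.circulant (fun x => 𝒞b x + t * (𝒞a x - 𝒞b x)) + constMat 1)) =
          ∫ y, g (fun s : ↥S => (ofLp y) (e s))
            ∂(multivariateGaussian (0 : EuclideanSpace ℝ (Fin d → ZMod Mb))
              (Matrix.circulant (fun z => 𝒞b' z + t * (𝒞a' z - 𝒞b' z)) + constMat 1)) := by
      intro t ht
      exact integral_comp_sel_multivariateGaussian_eq (hreg t ht) (hreg' t ht) (fun s : ↥S => (s : Fin d → ZMod M))
        (fun s : ↥S => e s) (fun s s' => hcov_t t s s.2 s' s'.2) hgm
    have hseg1 : (fun x => 𝒞b x + (1 : ℝ) * (𝒞a x - 𝒞b x)) = 𝒞a := by funext x; ring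
    have hseg0 : (fun x => 𝒞b x + (0 : ℝ) * (𝒞a x - 𝒞b x)) = 𝒞b := by funext x; ring
    have hseg1' : (fun z => 𝒞b' z + (1 : ℝ) * (𝒞a' z - 𝒞b' z)) = 𝒞a' := by funext z; ring
    have hseg0' : (fun z => 𝒞b' z + (0 : ℝ) * (𝒞a' z - 𝒞b' z)) = 𝒞b' := by funext z; ring
    have hsegm : (fun x => 𝒞b x + (2⁻¹ : ℝ) * (𝒞a x - 𝒞b x)) = 𝒞m := by
      funext x; simp only [h𝒞m]; ring
    have hmidm : (fun κ => mb κ + (2⁻¹ : ℝ) * (ma κ - mb κ)) = fun κ => 2⁻¹ * mb κ + 2⁻¹ * ma κ := by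
      funext κ; ring
    have hhalf : (2⁻¹ : ℝ) ∈ Set.Icc (0 : ℝ) 1 := ⟨by norm_num, by norm_num⟩
    have htra : ∫ ζ, G ζ ∂(stepMeasure 𝒞a) =
        ∫ y, Gs (ofLp y) ∂(multivariateGaussian (0 : EuclideanSpace ℝ (Fin d → ZMod Mb)) (mulMat ma)) := by
      rw [integral_stepMeasure_eq_integral_multivariateGaussian_add_constMat hSa.posSemidef zero_le_one
        hGcont.stronglyMeasurable hGinv, ← hSa'_eq]
      have h := htransfer 1 ⟨zero_le_one, le_rfl⟩
      rw [hseg1, hseg1'] at h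
      simp_rw [hG_eq_g]
      exact h
    have htrb : ∫ ζ, G ζ ∂(stepMeasure 𝒞b) =
        ∫ y, Gs (ofLp y) ∂(multivariateGaussian (0 : EuclideanSpace ℝ (Fin d → ZMod Mb)) (mulMat mb)) := by
      rw [integral_stepMeasure_eq_integral_multivariateGaussian_add_constMat hSb.posSemidef zero_le_one
        hGcont.stronglyMeasurable hGinv, ← hSb'_eq]
      have h := htransfer 0 ⟨le_rfl, zero_le_one⟩
      rw [hseg0, hseg0'] at h
      simp_rw [hG_eq_g]
      exact h
    have htrm : ∫ ζ, G ζ ∂(stepMeasure 𝒞m) =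
        ∫ y, Gs (ofLp y) ∂(multivariateGaussian (0 : EuclideanSpace ℝ (Fin d → ZMod Mb))
          (mulMat (fun κ => 2⁻¹ * mb κ + 2⁻¹ * ma κ))) := by
      rw [integral_stepMeasure_eq_integral_multivariateGaussian_add_constMat hSm.posSemidef zero_le_one
        hGcont.stronglyMeasurable hGinv]
      have h := htransfer 2⁻¹ hhalf
      rw [hsegm, ← hmt_eq 2⁻¹, hmidm] at h
      simp_rw [hG_eq_g]
      exact h
    rw [htra, htrb, htrm]
    -- (4) the `L^p` data along the small segment, transferred from the big torus
    have hbound_p : ∀ y : EuclideanSpace ℝ (Fin d → ZMod M),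
        ‖G (ofLp y)‖ ^ p ≤ ((s.factorial : ℝ) * C) ^ p * W.weight k X (φ + ofLp y) ^ p := by
      intro y
      rw [← Real.mul_rpow (by positivity) (W.weight_pos k X _).le]
      exact Real.rpow_le_rpow (norm_nonneg _) (hGbound (ofLp y)) hp0.le
    have hseg : ∀ t ∈ Set.Icc (0 : ℝ) 1,
        MemLp (fun y : EuclideanSpace ℝ (Fin d → ZMod Mb) => Gs (ofLp y)) (ENNReal.ofReal p)
            (multivariateGaussian 0 (mulMat (fun κ => mb κ + t * (ma κ - mb κ)))) ∧
          (∫ y, ‖Gs (ofLp y)‖ ^ p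
              ∂(multivariateGaussian 0 (mulMat (fun κ => mb κ + t * (ma κ - mb κ))))) ^ (1 / p) ≤
            (s.factorial : ℝ) * C * (Ap ^ (1 / p) * W.midWeight k X φ) := by
      intro t ht
      rw [hmt_eq t]
      set νt := multivariateGaussian (0 : EuclideanSpace ℝ (Fin d → ZMod M))
        (Matrix.circulant (fun x => 𝒞b x + t * (𝒞a x - 𝒞b x)) + constMat 1) with hνt
      set νt' := multivariateGaussian (0 : EuclideanSpace ℝ (Fin d → ZMod Mb))
        (Matrix.circulant (fun z => 𝒞b' z + t * (𝒞a' z - 𝒞b' z)) + constMat 1) with hνt'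
      obtain ⟨hwpt_int, hwpt_le⟩ := integral_weight_rpow_multivariateGaussian_add_constMat_le W hWl hD
        (hpsd_t t ht) zero_le_one hp0 (hSp t ht) hX φ
      -- the norm powers on the big torus
      have hnormp : Integrable (fun y : EuclideanSpace ℝ (Fin d → ZMod M) => ‖G (ofLp y)‖ ^ p) νt := by
        refine Integrable.mono' (hwpt_int.const_mul (((s.factorial : ℝ) * C) ^ p))
          (hGm.norm.rpow_const fun _ => Or.inr hp0.le).aestronglyMeasurable (ae_of_all _ fun y => ?_)
        rw [Real.norm_of_nonneg (by positivity)]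
        exact hbound_p y
      -- transfer of the norm powers
      set gp : (↥S → ℝ) → ℝ := fun u => ‖g u‖ ^ p with hgp
      have hgpm : StronglyMeasurable gp := (hgcont.norm.rpow_const fun _ => Or.inr hp0.le).stronglyMeasurable
      have hnormp_eq : ∫ y, ‖G (ofLp y)‖ ^ p ∂νt = ∫ y, ‖Gs (ofLp y)‖ ^ p ∂νt' := by
        have h := integral_comp_sel_multivariateGaussian_eq (hreg t ht) (hreg' t ht) (fun s : ↥S => (s : Fin d → ZMod M))
          (fun s : ↥S => e s) (fun s s' => hcov_t t s s.2 s' s'.2) hgpm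
        simp only [hgp] at h
        simp_rw [hG_eq_g]
        exact h
      have hint_iff := integrable_comp_sel_multivariateGaussian_iff (hreg t ht) (hreg' t ht)
        (fun s : ↥S => (s : Fin d → ZMod M)) (fun s : ↥S => e s) (fun s s' => hcov_t t s s.2 s' s'.2) hgpm
      have hnormp' : Integrable (fun y : EuclideanSpace ℝ (Fin d → ZMod Mb) => ‖Gs (ofLp y)‖ ^ p) νt' := by
        have h1 : Integrable (fun y : EuclideanSpace ℝ (Fin d → ZMod M) => gp (fun s : ↥S => (ofLp y) (s : Fin d → ZMod M))) νt := by
          refine hnormp.congr (ae_of_all _ fun y => ?_)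
          simp only [hgp]
          rw [hG_eq_g]
        have h2 := hint_iff.1 h1
        simpa only [hgp] using h2
      refine ⟨?_, ?_⟩
      · rw [← integrable_norm_rpow_iff hGsm.aestronglyMeasurable hpE ENNReal.ofReal_ne_top,
          ENNReal.toReal_ofReal hp0.le]
        exact hnormp'
      · rw [← hnormp_eq]
        have h1 : ∫ y, ‖G (ofLp y)‖ ^ p ∂νt ≤
            ((s.factorial : ℝ) * C) ^ p * (Ap * W.midWeight k X φ ^ p) := by
          calc ∫ y, ‖G (ofLp y)‖ ^ p ∂νt
              ≤ ∫ y, ((s.factorial : ℝ) * C) ^ p * W.weight k X (φ + ofLp y) ^ p ∂νt :=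
                integral_mono_of_nonneg (ae_of_all _ fun y => by positivity)
                  (hwpt_int.const_mul _) (ae_of_all _ fun y => hbound_p y)
            _ = ((s.factorial : ℝ) * C) ^ p * ∫ y, W.weight k X (φ + ofLp y) ^ p ∂νt :=
                integral_const_mul _ _
            _ ≤ ((s.factorial : ℝ) * C) ^ p * (Ap * W.midWeight k X φ ^ p) :=
                mul_le_mul_of_nonneg_left hwpt_le (by positivity)
        calc (∫ y, ‖G (ofLp y)‖ ^ p ∂νt) ^ (1 / p)
            ≤ (((s.factorial : ℝ) * C) ^ p * (Ap * W.midWeight k X φ ^ p)) ^ (1 / p) :=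
              Real.rpow_le_rpow (integral_nonneg fun y => by positivity) h1 (by positivity)
          _ = (s.factorial : ℝ) * C * (Ap ^ (1 / p) * W.midWeight k X φ) := by
              rw [Real.mul_rpow (by positivity) (mul_nonneg hAp0 (by positivity)),
                Real.mul_rpow hAp0 (by positivity), ← Real.rpow_mul (by positivity),
                ← Real.rpow_mul hwm.le, mul_one_div_cancel hp0.ne', Real.rpow_one, Real.rpow_one]
    -- (5) the dimension-free comparison along the small segment
    have hmain := norm_integral_mulMat_secondDiff_le_of_sum_sq_segment (m₀ := mb) (m₂ := ma) (ρ := ρ)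
      hmb_pos hma_pos hmb_ev hma_ev hρb hρa hhS hsum hpq
      (H := fun y : EuclideanSpace ℝ (Fin d → ZMod Mb) => Gs (ofLp y))
      (fun t ht => (hseg t ht).1) (fun t ht => (hseg t ht).2)
    refine hmain.trans (le_of_eq ?_)
    ring
  -- (6) sum over the Taylor orders
  show tayNorm T r₀ (fluct 𝒞a K - (2 : ℝ) • fluct 𝒞m K + fluct 𝒞b K) φ ≤ _
  unfold tayNorm
  calc ∑ s ∈ Finset.range (r₀ + 1), ((s.factorial : ℝ)⁻¹) *
        ‖iteratedFDeriv ℝ s (gaugeLift T (fluct 𝒞a K - (2 : ℝ) • fluct 𝒞m K + fluct 𝒞b K))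
          (T.rangeRestrict φ)‖
      ≤ ∑ _s ∈ Finset.range (r₀ + 1), C * (27 * q ^ 2 * hS ^ 2 * Ap ^ (1 / p)) * W.midWeight k X φ := by
        refine sum_le_sum fun s hs => ?_
        have hs' : s ≤ r₀ := Nat.lt_succ_iff.1 (mem_range.1 hs)
        have hfac : (0 : ℝ) < s.factorial := by positivity
        calc ((s.factorial : ℝ)⁻¹) *
              ‖iteratedFDeriv ℝ s (gaugeLift T (fluct 𝒞a K - (2 : ℝ) • fluct 𝒞m K + fluct 𝒞b K))
                (T.rangeRestrict φ)‖
            ≤ ((s.factorial : ℝ)⁻¹) *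
                ((s.factorial : ℝ) * C * (27 * q ^ 2 * hS ^ 2 * Ap ^ (1 / p)) * W.midWeight k X φ) :=
              mul_le_mul_of_nonneg_left (hterm s hs') (by positivity)
          _ = C * (27 * q ^ 2 * hS ^ 2 * Ap ^ (1 / p)) * W.midWeight k X φ := by
              field_simp
    _ = C * ((r₀ + 1) * (27 * q ^ 2 * hS ^ 2) * Ap ^ (1 / p)) * W.midWeight k X φ := by
        rw [sum_const, card_range, nsmul_eq_mul]
        push_cast
        ring


end Literature.MathematicalPhysics.StatisticalMechanics.GradientRG

end
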